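import Summits.KontsevichZagierPeriods.KontsevichZagierPeriods.Theorems.HurwitzMicroSectorsNormalFormPrincipleLevelTwoReduction
import Summits.KontsevichZagierPeriods.KontsevichZagierPeriods.Theorems.HurwitzMicroSectorsNormalFormPrincipleLevelNRigidNumbers

/-!
# `NormalFormPrinciple` (stmt-KontsevichZagierPeriods-3869), line `SketchIdeator1` — the leaf
# `stub_boxRigidity` in dimension two, LEVEL TWO, II: Conjecture 1 for `[(0,1)², P(x,y)/(1 − x²y²)]`

Pure proof file (lead seat c7, wave 3; `--supports` the crux; registered sub-goals
`boxRigidity_levelTwo_dim_two`, `boxRigidity_levelOne_levelTwo`; the reduction is the companion file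
`…LevelTwoReduction.lean`). After level one (`…LevelOne.lean`,
unconditional) the next rung of Kontsevich–Zagier's box family: all `[(0,1)², P/(1 − x₀²x₁²)]`,
`P ∈ ℚ[x₀,x₁]`, whose values fill `ℚ + ℚπ² + ℚ log 2` (`∫∫ dxdy/(1−x²y²) = Σ 1/(2k+1)² = π²/8`,
`∫∫ x dxdy/(1−x²y²) = ½ log 2`). THREE ENGINES MEET:

* the MERGE GADGET at level `N` (`merge_box_sub_triangle_levelN`, `triangle_sub_dimOne_levelN`, stated
  for every `N ≥ 1`): an off-diagonal monomial `c x₀^a x₁^b/(1 − (x₀x₁)^N)`, `a > b`, becomes the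
  dimension-ONE representation `[(0,1), (c/(a−b)) s^b (Σ_{i<a−b} sⁱ)/(Σ_{i<N} sⁱ)]` — a box-rational
  representation with a cyclotomic denominator, the input format of the dimension-one layers;
* at level two `Σ_{i<2} sⁱ = 1 + s` and `[(0,1), p(s)/(1+s)] ≡ γ[(1,2), 1/y] + [pt, a]` by one affine
  move into the DLOG family of seat c3 (`dimOne_levelTwo_reduce`);
* the route's DILATION MOVE (closed crux 3872): `3[(0,1)², t/(1−t²)] ≡ [(0,1)², 1/(1−t²)]`
  (`diagOdd_levelTwo_sub_mem_relations`), so the diagonal has ONE carrier.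

Results: `levelTwo_reduce` — normal form `β[(0,1)², 1/(1−x₀²x₁²)] + γ[(1,2), 1/y] + [pt, q]`;
`levelTwo_value` — value `β·π²/8 + γ·log 2 + q`; `boxRigidity_levelTwo_dim_two` — **Conjecture 1 on the
level-two family ⟸ `LinearIndependent ℚ ![1, π², log 2]`** (open; Schanuel-implied); and the JOINT
statement with level one (`levelOneRep_sub_levelTwoRep_mem_relations`: `[β/(1−xy)] ≡ [(4β/3)/(1−x²y²)]`,
Euler's `ζ(2) = (4/3)Σ1/(2k+1)²` inside the calculus; `boxRigidity_levelOne_levelTwo`), with the kernel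
form on the subgroup generated by both families and all polynomial boxes
(`levelTwo_mem_relations_of_eval_eq_zero`).
Sources: M. Kontsevich, D. Zagier, *Periods* (2001), §1.2 Conjecture 1, rules (1)–(3).
No definitions are introduced.
-/

noncomputable section

open MeasureTheory Set
open scoped Polynomial
open Literature.NumberTheory.Transcendental Literature.NumberTheory.Transcendental.KZ
open Literature.ModelTheory.ExponentialFields (IsSemialgebraic)

namespace Summit.KontsevichZagierPeriods.HurwitzMicroSectors.NormalFormPrinciple.PiBox.LevelN

open Summit.KontsevichZagierPeriods.HurwitzMicroSectors.NormalFormPrinciple.PiBox.Dlog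
  (exists_ptCarrier value_pt pt_add_mem_relations pt_zero_mem_relations pt_congr_mem_relations
   exists_dlog value_dlog dlog_congr_mem_relations dlog_zero_mem_relations dlog_merge_mem_relations
   exists_rep_unit)
open Summit.KontsevichZagierPeriods.HurwitzMicroSectors.NormalFormPrinciple.PiBox.LevelOne
  (exists_boxPolyRep boxPoly_exists_pt aeval_monomial_two diag_identity one_sub_mul_pos_of_mem_box)

/-! ## Composition (lead): rigidity at level two -/

/-- **Two representations with level-two normal forms and equal values are KZ-equivalent**, under
`Indep_ℚ(1, π², log 2)`: the values `β·π²/8 + γ·log 2 + q` determine `(β, γ, q)`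
(`levelTwo_rigid_numbers`), and representations with a common normal form differ by a relation.
[cite: KontsevichZagier2001, §1.2 Conjecture 1] -/
theorem equivalent_of_levelTwoNF (hind : LinearIndependent ℚ ![(1:ℝ), Real.pi ^ 2, Real.log 2])
    {N N' : IntegralRep 2} {β γ q β' γ' q' : ℚ}
    (h : ∀ (B : IntegralRep 2) (L : IntegralRep 1) (Z : IntegralRep 0),
        B.domain = {x | ∀ i, x i ∈ Set.Ioo (0:ℝ) 1} →
        EqOn B.integrand (fun x => (β : ℝ) / (1 - (x 0 * x 1) ^ 2)) B.domain →
        L.domain = {x | x 0 ∈ Set.Ioo (1:ℝ) 2} → EqOn L.integrand (fun x => (γ : ℝ) / x 0) L.domain →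
        Z.domain = Set.univ → (Z.integrand = fun _ => (q : ℝ)) →
        of N - of B - of L - of Z ∈ relations)
    (h' : ∀ (B : IntegralRep 2) (L : IntegralRep 1) (Z : IntegralRep 0),
        B.domain = {x | ∀ i, x i ∈ Set.Ioo (0:ℝ) 1} →
        EqOn B.integrand (fun x => (β' : ℝ) / (1 - (x 0 * x 1) ^ 2)) B.domain →
        L.domain = {x | x 0 ∈ Set.Ioo (1:ℝ) 2} → EqOn L.integrand (fun x => (γ' : ℝ) / x 0) L.domain →
        Z.domain = Set.univ → (Z.integrand = fun _ => (q' : ℝ)) →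
        of N' - of B - of L - of Z ∈ relations)
    (hv : N.value = N'.value) : Equivalent N N' := by
  have hvN := levelTwo_value h
  have hvN' := levelTwo_value h'
  obtain ⟨rfl, rfl, rfl⟩ := levelTwo_rigid_numbers hind β γ q β' γ' q' (by rw [← hvN, ← hvN', hv])
  obtain ⟨B, hBd, hBi⟩ := exists_levelTwoRep β
  obtain ⟨L, hLd, hLi⟩ := exists_dlog 1 2 γ one_pos
  obtain ⟨Zf, hZf⟩ := exists_ptCarrier
  have hLd' : L.domain = {x | x 0 ∈ Set.Ioo (1:ℝ) 2} := by rw [hLd]; push_cast; rfl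
  have hLi' : EqOn L.integrand (fun x => (γ : ℝ) / x 0) L.domain := by rw [hLi]; exact fun _ _ => rfl
  have e₁ := h B L (Zf q) hBd hBi hLd' hLi' (hZf q).1 (hZf q).2
  have e₂ := h' B L (Zf q) hBd hBi hLd' hLi' (hZf q).1 (hZf q).2
  have e : of N - of N' = (of N - of B - of L - of (Zf q)) - (of N' - of B - of L - of (Zf q)) := by abel
  show of N - of N' ∈ relations
  rw [e]
  exact relations.sub_mem e₁ e₂

/-- **`stub_boxRigidity` in dimension two, LEVEL TWO, conditionally on `Indep_ℚ(1, π², log 2)`**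
(Conjecture 1 of Kontsevich–Zagier for all pairs `[(0,1)², P/(1 − x₀²x₁²)]`, `[(0,1)², P'/(1 − x₀²x₁²)]`,
`P, P' ∈ ℚ[x₀,x₁]`). Three engines meet here: the merge gadget (this seat), the route's dilation move
(`H₀ ∼ 3H₁` at level two) and the dimension-one dlog layer (seat c3).
[cite: KontsevichZagier2001, §1.2 Conjecture 1] -/
theorem boxRigidity_levelTwo_dim_two (hind : LinearIndependent ℚ ![(1:ℝ), Real.pi ^ 2, Real.log 2])
    (N N' : IntegralRep 2) (P P' : MvPolynomial (Fin 2) ℚ)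
    (hNd : N.domain = {x | ∀ i, x i ∈ Set.Ioo (0:ℝ) 1})
    (hNi : EqOn N.integrand (fun x => (MvPolynomial.aeval x P : ℝ) / (1 - (x 0 * x 1) ^ 2)) N.domain)
    (hN'd : N'.domain = {x | ∀ i, x i ∈ Set.Ioo (0:ℝ) 1})
    (hN'i : EqOn N'.integrand (fun x => (MvPolynomial.aeval x P' : ℝ) / (1 - (x 0 * x 1) ^ 2)) N'.domain)
    (hv : N.value = N'.value) : Equivalent N N' := by
  obtain ⟨β, γ, q, h⟩ := levelTwo_reduce P N hNd hNi
  obtain ⟨β', γ', q', h'⟩ := levelTwo_reduce P' N' hN'd hN'i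
  exact equivalent_of_levelTwoNF hind h h' hv

/-! ### Levels one and two together: `3[(0,1)², 1/(1 − xy)] ≡ 4[(0,1)², 1/(1 − x²y²)]` -/

/-- **The level-one carrier in the level-two normal form**: `[(0,1)², β/(1 − x₀x₁)] ≡
[(0,1)², (4β/3)/(1 − x₀²x₁²)]` (rule 1b `1/(1−t) = 1/(1−t²) + t/(1−t²)` and the dilation
`3[t/(1−t²)] ≡ [1/(1−t²)]`) — Euler's `ζ(2) = (4/3)·Σ 1/(2k+1)²` inside the calculus.
[cite: KontsevichZagier2001, §1.2] -/
theorem levelOneRep_sub_levelTwoRep_mem_relations (β : ℚ) (B₁ B₂ : IntegralRep 2)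
    (hB₁d : B₁.domain = {x | ∀ i, x i ∈ Set.Ioo (0:ℝ) 1})
    (hB₁i : EqOn B₁.integrand (fun x => (β : ℝ) / (1 - x 0 * x 1)) B₁.domain)
    (hB₂d : B₂.domain = {x | ∀ i, x i ∈ Set.Ioo (0:ℝ) 1})
    (hB₂i : EqOn B₂.integrand (fun x => ((4 * β / 3 : ℚ) : ℝ) / (1 - (x 0 * x 1) ^ 2)) B₂.domain) :
    of B₁ - of B₂ ∈ relations := by
  obtain ⟨S, hSd, hSi⟩ := exists_levelNRep 2 (by norm_num)
    (MvPolynomial.C β * (MvPolynomial.X 0 * MvPolynomial.X 1))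
  have hSi' : EqOn S.integrand (fun x => (β : ℝ) * (x 0 * x 1) / (1 - (x 0 * x 1) ^ 2)) S.domain :=
    fun x _ => by rw [hSi]; simp
  obtain ⟨T, hTd, hTi⟩ := exists_levelTwoRep β
  obtain ⟨U, hUd, hUi⟩ := exists_levelTwoRep (β / 3)
  have hsplit : of B₁ - of T - of S ∈ relations := by
    refine integrandAddRel_subset_relations ⟨2, B₁, T, S, hTd.trans hB₁d.symm, hSd.trans hB₁d.symm,
      fun x hx => ?_, rfl⟩
    have hxT : x ∈ T.domain := by rw [hTd, ← hB₁d]; exact hx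
    have hxS : x ∈ S.domain := by rw [hSd, ← hB₁d]; exact hx
    have hx' : ∀ i, x i ∈ Set.Ioo (0:ℝ) 1 := by rw [hB₁d] at hx; exact hx
    have h0 := hx' 0; have h1 := hx' 1
    have hp : 0 < x 0 * x 1 := mul_pos h0.1 h1.1
    have hlt : x 0 * x 1 < 1 := by nlinarith [h0.1, h0.2, h1.1, h1.2]
    have ht1 : 1 - x 0 * x 1 ≠ 0 := (sub_pos.2 hlt).ne'
    have ht2 : 1 + x 0 * x 1 ≠ 0 := by linarith
    rw [Pi.add_apply, hB₁i hx, hTi hxT, hSi' hxS]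
    dsimp only
    have e2 : 1 - (x 0 * x 1) ^ 2 = (1 - x 0 * x 1) * (1 + x 0 * x 1) := by ring
    rw [e2]
    field_simp
  have hdil := diagOdd_levelTwo_sub_mem_relations β S U hSd hSi' hUd hUi
  have h43 : (4 * β / 3 : ℚ) = β + β / 3 := by ring
  rw [h43] at hB₂i
  have hadd := levelTwoRep_add_mem_relations B₂ T U hB₂d hB₂i hTd hTi hUd hUi
  have e : of B₁ - of B₂ = (of B₁ - of T - of S) + (of S - of U) - (of B₂ - of T - of U) := by abel
  rw [e]
  exact relations.sub_mem (relations.add_mem hsplit hdil) hadd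

/-- **A level-one representation has a level-two normal form** `(4β/3, 0, q)`.
[cite: KontsevichZagier2001, §1.2] -/
theorem levelTwoNF_of_levelOne (P : MvPolynomial (Fin 2) ℚ) (N : IntegralRep 2)
    (hNd : N.domain = {x | ∀ i, x i ∈ Set.Ioo (0:ℝ) 1})
    (hNi : EqOn N.integrand (fun x => (MvPolynomial.aeval x P : ℝ) / (1 - x 0 * x 1)) N.domain) :
    ∃ β γ q : ℚ, ∀ (B : IntegralRep 2) (L : IntegralRep 1) (Z : IntegralRep 0),
        B.domain = {x | ∀ i, x i ∈ Set.Ioo (0:ℝ) 1} →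
        EqOn B.integrand (fun x => (β : ℝ) / (1 - (x 0 * x 1) ^ 2)) B.domain →
        L.domain = {x | x 0 ∈ Set.Ioo (1:ℝ) 2} → EqOn L.integrand (fun x => (γ : ℝ) / x 0) L.domain →
        Z.domain = Set.univ → (Z.integrand = fun _ => (q : ℝ)) →
        of N - of B - of L - of Z ∈ relations := by
  obtain ⟨β, q, h⟩ := LevelOne.levelOne_reduce P N hNd hNi
  refine ⟨4 * β / 3, 0, q, fun B L Z hBd hBi hLd hLi hZd hZi => ?_⟩
  obtain ⟨B₁, hB₁d, hB₁i⟩ := LevelOne.exists_zetaTwoRep β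
  have e₁ := h B₁ Z hB₁d hB₁i hZd hZi
  have e₂ := levelOneRep_sub_levelTwoRep_mem_relations β B₁ B hB₁d hB₁i hBd hBi
  have e₃ := dlog_zero_mem_relations L hLi
  have e : of N - of B - of L - of Z = (of N - of B₁ - of Z) + (of B₁ - of B) - of L := by abel
  rw [e]
  exact relations.sub_mem (relations.add_mem e₁ e₂) e₃

/-- **Levels one and two together, conditionally on `Indep_ℚ(1, π², log 2)`**: a representation
`[(0,1)², P/(1 − x₀x₁)]` and a representation `[(0,1)², P'/(1 − x₀²x₁²)]` with equal values are
KZ-equivalent (e.g. `3[(0,1)², 1/(1−xy)] ≡ 4[(0,1)², 1/(1−x²y²)]`, both `π²/2`).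
[cite: KontsevichZagier2001, §1.2 Conjecture 1] -/
theorem boxRigidity_levelOne_levelTwo (hind : LinearIndependent ℚ ![(1:ℝ), Real.pi ^ 2, Real.log 2])
    (N N' : IntegralRep 2) (P P' : MvPolynomial (Fin 2) ℚ)
    (hNd : N.domain = {x | ∀ i, x i ∈ Set.Ioo (0:ℝ) 1})
    (hNi : EqOn N.integrand (fun x => (MvPolynomial.aeval x P : ℝ) / (1 - x 0 * x 1)) N.domain)
    (hN'd : N'.domain = {x | ∀ i, x i ∈ Set.Ioo (0:ℝ) 1})
    (hN'i : EqOn N'.integrand (fun x => (MvPolynomial.aeval x P' : ℝ) / (1 - (x 0 * x 1) ^ 2)) N'.domain)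
    (hv : N.value = N'.value) : Equivalent N N' := by
  obtain ⟨β, γ, q, h⟩ := levelTwoNF_of_levelOne P N hNd hNi
  obtain ⟨β', γ', q', h'⟩ := levelTwo_reduce P' N' hN'd hN'i
  exact equivalent_of_levelTwoNF hind h h' hv

/-! ### Kernel form on the subgroup generated by levels one and two and the polynomial boxes -/

/-- **Level-two normal forms on the subgroup** generated by the level-two family, the level-one family and
all polynomial boxes (generator by generator: `levelTwo_reduce`, `levelTwoNF_of_levelOne`,
`LevelOne.boxPoly_exists_pt`; sums and negatives by rule (1b)). [cite: KontsevichZagier2001, §1.2] -/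
theorem exists_levelTwoNF_of_mem_closure {c : FormalRep}
    (hc : c ∈ AddSubgroup.closure
      ({y : FormalRep | ∃ (P : MvPolynomial (Fin 2) ℚ) (N : IntegralRep 2),
          N.domain = {x | ∀ i, x i ∈ Set.Ioo (0:ℝ) 1} ∧
          EqOn N.integrand (fun x => (MvPolynomial.aeval x P : ℝ) / (1 - (x 0 * x 1) ^ 2)) N.domain ∧
          y = of N} ∪
       {y : FormalRep | ∃ (P : MvPolynomial (Fin 2) ℚ) (N : IntegralRep 2),
          N.domain = {x | ∀ i, x i ∈ Set.Ioo (0:ℝ) 1} ∧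
          EqOn N.integrand (fun x => (MvPolynomial.aeval x P : ℝ) / (1 - x 0 * x 1)) N.domain ∧
          y = of N} ∪
       {y : FormalRep | ∃ (m : ℕ) (p : MvPolynomial (Fin m) ℚ) (N : IntegralRep m),
          N.domain = {x | ∀ i, x i ∈ Set.Ioo (0:ℝ) 1} ∧
          EqOn N.integrand (fun x => (MvPolynomial.aeval x p : ℝ)) N.domain ∧ y = of N})) :
    ∃ β γ q : ℚ, ∀ (B : IntegralRep 2) (L : IntegralRep 1) (Z : IntegralRep 0),
        B.domain = {x | ∀ i, x i ∈ Set.Ioo (0:ℝ) 1} →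
        EqOn B.integrand (fun x => (β : ℝ) / (1 - (x 0 * x 1) ^ 2)) B.domain →
        L.domain = {x | x 0 ∈ Set.Ioo (1:ℝ) 2} → EqOn L.integrand (fun x => (γ : ℝ) / x 0) L.domain →
        Z.domain = Set.univ → (Z.integrand = fun _ => (q : ℝ)) →
        c - of B - of L - of Z ∈ relations := by
  obtain ⟨Zf, hZf⟩ := exists_ptCarrier
  induction hc using AddSubgroup.closure_induction with
  | mem y hy =>
    rcases hy with (⟨P, N, hNd, hNi, rfl⟩ | ⟨P, N, hNd, hNi, rfl⟩) | ⟨m, p, N, hNd, hNi, rfl⟩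
    · exact levelTwo_reduce P N hNd hNi
    · exact levelTwoNF_of_levelOne P N hNd hNi
    · obtain ⟨q, hq⟩ := LevelOne.boxPoly_exists_pt p N hNd hNi
      refine ⟨0, 0, q, fun B L Z hBd hBi hLd hLi hZd hZi => ?_⟩
      have e : of N - of B - of L - of Z = (of N - of Z) - of B - of L := by abel
      rw [e]
      exact relations.sub_mem (relations.sub_mem (hq Z hZd hZi) (levelTwoRep_zero_mem_relations B hBi))
        (dlog_zero_mem_relations L hLi)
  | zero =>
    refine ⟨0, 0, 0, fun B L Z hBd hBi hLd hLi hZd hZi => ?_⟩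
    have e : (0 : FormalRep) - of B - of L - of Z = -(of B) - of L - of Z := by abel
    rw [e]
    exact relations.sub_mem (relations.sub_mem (relations.neg_mem (levelTwoRep_zero_mem_relations B hBi))
      (dlog_zero_mem_relations L hLi)) (pt_zero_mem_relations Z (by rw [hZi]; push_cast; rfl))
  | add y z _ _ ihy ihz =>
    obtain ⟨β₁, γ₁, q₁, h₁⟩ := ihy
    obtain ⟨β₂, γ₂, q₂, h₂⟩ := ihz
    refine ⟨β₁ + β₂, γ₁ + γ₂, q₁ + q₂, fun B L Z hBd hBi hLd hLi hZd hZi => ?_⟩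
    obtain ⟨B₁, hB₁d, hB₁i⟩ := exists_levelTwoRep β₁
    obtain ⟨B₂, hB₂d, hB₂i⟩ := exists_levelTwoRep β₂
    obtain ⟨L₁, hL₁d, hL₁i⟩ := exists_dlog 1 2 γ₁ one_pos
    obtain ⟨L₂, hL₂d, hL₂i⟩ := exists_dlog 1 2 γ₂ one_pos
    have hL₁d' : L₁.domain = {x | x 0 ∈ Set.Ioo (1:ℝ) 2} := by rw [hL₁d]; push_cast; rfl
    have hL₂d' : L₂.domain = {x | x 0 ∈ Set.Ioo (1:ℝ) 2} := by rw [hL₂d]; push_cast; rfl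
    have e₁ := h₁ B₁ L₁ (Zf q₁) hB₁d hB₁i hL₁d' (by rw [hL₁i]; exact fun _ _ => rfl) (hZf q₁).1 (hZf q₁).2
    have e₂ := h₂ B₂ L₂ (Zf q₂) hB₂d hB₂i hL₂d' (by rw [hL₂i]; exact fun _ _ => rfl) (hZf q₂).1 (hZf q₂).2
    have eB := levelTwoRep_add_mem_relations B B₁ B₂ hBd hBi hB₁d hB₁i hB₂d hB₂i
    have eL := dlog_merge_mem_relations L L₁ L₂ hLd hL₁d' hL₂d' hLi
      (by rw [hL₁i]; exact fun _ _ => rfl) (by rw [hL₂i]; exact fun _ _ => rfl)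
    have eZ := pt_add_mem_relations Z (Zf q₁) (Zf q₂) hZd (hZf q₁).1 (hZf q₂).1
      (by rw [hZi]; push_cast; rfl) (hZf q₁).2 (hZf q₂).2
    have e : y + z - of B - of L - of Z = (y - of B₁ - of L₁ - of (Zf q₁)) +
        (z - of B₂ - of L₂ - of (Zf q₂)) - (of B - of B₁ - of B₂) - (of L - of L₁ - of L₂) -
        (of Z - of (Zf q₁) - of (Zf q₂)) := by abel
    rw [e]
    exact relations.sub_mem (relations.sub_mem (relations.sub_mem (relations.add_mem e₁ e₂) eB) eL) eZ
  | neg y _ ih =>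
    obtain ⟨β, γ, q, h⟩ := ih
    refine ⟨-β, -γ, -q, fun B L Z hBd hBi hLd hLi hZd hZi => ?_⟩
    obtain ⟨B₁, hB₁d, hB₁i⟩ := exists_levelTwoRep β
    obtain ⟨L₁, hL₁d, hL₁i⟩ := exists_dlog 1 2 γ one_pos
    have hL₁d' : L₁.domain = {x | x 0 ∈ Set.Ioo (1:ℝ) 2} := by rw [hL₁d]; push_cast; rfl
    have e₁ := h B₁ L₁ (Zf q) hB₁d hB₁i hL₁d' (by rw [hL₁i]; exact fun _ _ => rfl) (hZf q).1 (hZf q).2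
    have eB : of B₁ + of B ∈ relations :=
      of_add_of_mem_relations_of_eqOn_neg (hBd.trans hB₁d.symm) fun x hx => by
        rw [Pi.neg_apply, hB₁i hx, hBi (by rw [hBd, ← hB₁d]; exact hx)]
        push_cast
        ring
    have eL : of L₁ + of L ∈ relations :=
      of_add_of_mem_relations_of_eqOn_neg (hLd.trans hL₁d'.symm) fun x hx => by
        rw [Pi.neg_apply, hL₁i, hLi (by rw [hLd, ← hL₁d']; exact hx)]
        push_cast
        ring
    have eZ : of (Zf q) + of Z ∈ relations :=
      of_add_of_mem_relations_of_eqOn_neg (hZd.trans (hZf q).1.symm) fun x _ => by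
        rw [Pi.neg_apply, (hZf q).2, hZi]
        push_cast
        ring
    have e : -y - of B - of L - of Z =
        -(y - of B₁ - of L₁ - of (Zf q)) - (of B₁ + of B) - (of L₁ + of L) - (of (Zf q) + of Z) := by abel
    rw [e]
    exact relations.sub_mem (relations.sub_mem (relations.sub_mem (relations.neg_mem e₁) eB) eL) eZ

/-- **Conjecture 1, kernel form, on the subgroup generated by the level-two family, the level-one
family and all polynomial boxes, conditionally on `Indep_ℚ(1, π², log 2)`**: a formal `ℤ`-combination
with value `0` is a Kontsevich–Zagier relation (its normal form has value `β·π²/8 + γ·log 2 + q = 0`, so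
`β = γ = q = 0`). [cite: KontsevichZagier2001, §1.2 Conjecture 1] -/
theorem levelTwo_mem_relations_of_eval_eq_zero
    (hind : LinearIndependent ℚ ![(1:ℝ), Real.pi ^ 2, Real.log 2]) {c : FormalRep}
    (hc : c ∈ AddSubgroup.closure
      ({y : FormalRep | ∃ (P : MvPolynomial (Fin 2) ℚ) (N : IntegralRep 2),
          N.domain = {x | ∀ i, x i ∈ Set.Ioo (0:ℝ) 1} ∧
          EqOn N.integrand (fun x => (MvPolynomial.aeval x P : ℝ) / (1 - (x 0 * x 1) ^ 2)) N.domain ∧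
          y = of N} ∪
       {y : FormalRep | ∃ (P : MvPolynomial (Fin 2) ℚ) (N : IntegralRep 2),
          N.domain = {x | ∀ i, x i ∈ Set.Ioo (0:ℝ) 1} ∧
          EqOn N.integrand (fun x => (MvPolynomial.aeval x P : ℝ) / (1 - x 0 * x 1)) N.domain ∧
          y = of N} ∪
       {y : FormalRep | ∃ (m : ℕ) (p : MvPolynomial (Fin m) ℚ) (N : IntegralRep m),
          N.domain = {x | ∀ i, x i ∈ Set.Ioo (0:ℝ) 1} ∧
          EqOn N.integrand (fun x => (MvPolynomial.aeval x p : ℝ)) N.domain ∧ y = of N}))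
    (hv : eval c = 0) : c ∈ relations := by
  obtain ⟨β, γ, q, h⟩ := exists_levelTwoNF_of_mem_closure hc
  obtain ⟨B, hBd, hBi⟩ := exists_levelTwoRep β
  obtain ⟨L, hLd, hLi⟩ := exists_dlog 1 2 γ one_pos
  obtain ⟨Zf, hZf⟩ := exists_ptCarrier
  have hLd' : L.domain = {x | x 0 ∈ Set.Ioo (1:ℝ) 2} := by rw [hLd]; push_cast; rfl
  have hLi' : EqOn L.integrand (fun x => (γ : ℝ) / x 0) L.domain := by rw [hLi]; exact fun _ _ => rfl
  have e₁ := h B L (Zf q) hBd hBi hLd' hLi' (hZf q).1 (hZf q).2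
  have h0 := relations_le_ker_eval_holds e₁
  have hvL := value_dlog L hLd hLi' one_pos (by norm_num)
  rw [AddMonoidHom.mem_ker, map_sub, map_sub, map_sub, hv, eval_of, eval_of, eval_of,
    value_levelTwoRep β B hBd hBi, hvL, value_pt (Zf q) (hZf q).1 (hZf q).2] at h0
  push_cast at h0
  rw [div_one] at h0
  obtain ⟨rfl, rfl, rfl⟩ := levelTwo_rigid_numbers hind β γ q 0 0 0 (by push_cast; linarith)
  have eB := levelTwoRep_zero_mem_relations B hBi
  have eL := dlog_zero_mem_relations L hLi'
  have eZ := pt_zero_mem_relations (Zf 0) (by rw [(hZf 0).2]; push_cast; rfl)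
  have e : c = (c - of B - of L - of (Zf 0)) + of B + of L + of (Zf 0) := by abel
  rw [e]
  exact relations.add_mem (relations.add_mem (relations.add_mem e₁ eB) eL) eZ

/-- **The level-two layer in the `IsRational` vocabulary of the leaf `stub_boxRigidity`**, conditionally
on `Indep_ℚ(1, π², log 2)`: two representations on `(0,1)²` whose integrands agree on the box with `p/q`,
`p ∈ ℚ[x₀,x₁]`, `q = 1 − x₀²x₁²`, and whose values agree are KZ-equivalent.
[cite: KontsevichZagier2001, §1.2 Conjecture 1] -/
theorem boxRigidity_levelTwo (hind : LinearIndependent ℚ ![(1:ℝ), Real.pi ^ 2, Real.log 2])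
    (N N' : IntegralRep 2)
    (hNd : N.domain = {x | ∀ i, x i ∈ Set.Ioo (0:ℝ) 1})
    (hN : ∃ p : MvPolynomial (Fin 2) ℚ, EqOn N.integrand
      (fun x => (MvPolynomial.aeval x p : ℝ) /
        MvPolynomial.aeval x (1 - (MvPolynomial.X 0 * MvPolynomial.X 1) ^ 2 : MvPolynomial (Fin 2) ℚ))
      N.domain)
    (hN'd : N'.domain = {x | ∀ i, x i ∈ Set.Ioo (0:ℝ) 1})
    (hN' : ∃ p : MvPolynomial (Fin 2) ℚ, EqOn N'.integrand
      (fun x => (MvPolynomial.aeval x p : ℝ) /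
        MvPolynomial.aeval x (1 - (MvPolynomial.X 0 * MvPolynomial.X 1) ^ 2 : MvPolynomial (Fin 2) ℚ))
      N'.domain)
    (hv : N.value = N'.value) : Equivalent N N' := by
  obtain ⟨P, hP⟩ := hN
  obtain ⟨P', hP'⟩ := hN'
  refine boxRigidity_levelTwo_dim_two hind N N' P P' hNd (fun x hx => ?_) hN'd (fun x hx => ?_) hv
  · rw [hP hx]; simp
  · rw [hP' hx]; simp

end Summit.KontsevichZagierPeriods.HurwitzMicroSectors.NormalFormPrinciple.PiBox.LevelN
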